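import Summits.QuantumAdvantage.AdviceFreeQNC0.AffBells35PolyLossOfIFM
import Summits.QuantumAdvantage.AdviceFreeQNC0.AffBells22WalkHardAllSubcube
import Summits.QuantumAdvantage.AdviceFreeQNC0.WalkTransport
import HarnessLib

/-!
# AffBells36 — PAIR SLICING and the ALIGNMENT form of the last box (planner qa-qnc0-p1 g36, ROUND-35 §4.5–§4.6)

**The move.**  In the tree's walk chart (`WalkTransport`: `u = uVec x`, `x_j = xOfU u j = ¬(u_j ⊕ u_{j−1})`,
`u_{−1} = false`, `u_n = true`; odd inputs `x ∈ {0,1}^{n+1}` ↔ `u ∈ {0,1}^n`) flipping ONE walk coordinate `u_j`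
flips the ADJACENT input pair `x_j, x_{j+1}` and nothing else.  For a coefficient pattern `γ` call the pair BLIND
(`Blind γ x j`) when it is tied (`x_j = x_{j+1}`) with `γ_j + γ_{j+1} = 0`, or anti-tied with `γ_j = γ_{j+1}`: then
every `𝔽₃`-linear form whose coefficients on the pair are a multiple of `(γ_j, γ_{j+1})` is invariant under the flip
(`linForm_adjFlip_of_aligned`).  Whether the pair at `j` is tied is `[u_{j−1} = u_{j+1}]`, so once all walk coordinates
other than the pair-firsts are fixed, blindness of each pair is decided, and over the uniform measure the blindness
bits of a pairing are independent fair coins (they are the XORs `u_{j−1} ⊕ u_{j+1}` of distinct separator coordinates).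

**Consequence (the analytic half, CLAIMED PROVABLE FROM THE TREE — prover target `PairAlignedHard`).**  Let every row
of an affine MOD₃ strategy be ALIGNED with one `γ` at all but `(log₂ N)^C` pairs of an adjacent pairing `P`,
`|P| ≥ N/c₀` (`RowAligned`, `misaligned`; coefficients OFF the pairs are unconstrained).  Partition the u-cube: fix
every coordinate except the firsts of the pairs of `P` that are blind given the fixed ones (a value-dependent but
genuine partition into subcubes).  On each part every row's linear form is a constant plus an invariant aligned part
plus a function of its `≤ (log₂ N)^C` misaligned free bits, so the transported walk strategy
`y_g(u) = z_g(xOfU u) ⊕ tGuess(xOfU u)_g` (`rel_iff_ringWinU`, `hasDeg_transport`) has `𝔽₂`-degree `≤ (log₂ N)^C` in the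
free bits, and `AffBells22.walkHardAllSubcube δ₀` (EVERY `δ₀ < 1`; here `δ₀ = 1 − 1/(4c₀)`) bounds the wins on the part
by `θ·|part|`; parts with fewer than `|P|/4` blind pairs carry total mass `≤ 2^n·exp(−|P|/8)` (binomial tail).  Summing:
`affWinCard β c ≤ θ'·2^{N−1}`.  TEMPLATE for the Lean proof: `AffBells23.RingCond.ringCondOfSubcube`
(AffBells23RingCond/RingCondProofs: the same fibrewise transport with the coarser partition `u|_{shadow W}`), plus the
refinement step and a binomial tail.  No exponential sums, no `p = 3` resonance, no new engine.

**The structural half (OPEN — the last box, ALIGNMENT FORM `NearPerfectAligned`).**  Every near-perfect affine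
strategy admits such a `γ` and pairing.  This replaces `ClassSimulation GoodPrefix` of exp36/SimClass36: no tables, no
one-sided defect, no registers, no common set `W` — a statement about the coefficient matrix `β` alone.  What the flip
calculus of ROUND-34/35 gives towards it: wide rows of near-perfect strategies are dressed staircases `[S_m + window]`
of ONE register per wire (aligned except at the cut and the window), proportional overlapping wires are aligned
(`λ = 2`); NOT covered: two non-proportional wires on a common macroscopic arc (ROUND-35 §3.3) and «medium» rows.

`polyLoss_of_alignment : PairAlignedHard → NearPerfectAligned → AffBellsPolyLoss3` is proved here (contradiction for
large `N`).  Crux 22907 / route DWalkThree untouched; nothing here is a route item.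

Ported to the tree verbatim by the prover seat qn-prover-3 g20 (ask of planner qa-qnc0-p1 g36, ROUND-35 §6 / P-36d; `HOME/qa-qnc0-p1/exp36/PairSlice36.lean`,
farm rc 0 / 0 sorry / 0 warn); serves stmt-QuantumAdvantage-22907 (untagged: the gate refuses `--supports` across sub-problems).
-/

noncomputable section

open Classical

namespace Summit.QuantumAdvantage.AdviceFreeQNC0.AffBells36

open Finset Literature.Computability.QuantumComplexity Literature.Computability.QuantumComplexity.RingHLF
open AffBells22 AffBells23 AffBells26

variable {N : ℕ}

/-! ### Linear forms and adjacent pair flips -/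

/-- the `𝔽₃`-linear form of a coefficient row. -/
def linForm (b : Fin N → ZMod 3) (x : Fin N → Bool) : ZMod 3 := ∑ i : Fin N, if x i then b i else 0

/-- `affBell_eq_linForm` (planner qa-qnc0-p1 g36, exp36/PairSlice36.lean). -/
theorem affBell_eq_linForm (β : Fin N → Fin N → ZMod 3) (c : Fin N → ZMod 3) (x : Fin N → Bool) (k : Fin N) :
    affBell β c x k = decide (linForm (β k) x = c k) := rfl

/-- flip the adjacent pair `j, j+1` (the effect on `x` of flipping the walk coordinate `u_j`). -/
def adjFlip (j : Fin N) (hj : j.val + 1 < N) (x : Fin N → Bool) : Fin N → Bool :=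
  fun i => if i = j ∨ i = ⟨j.val + 1, hj⟩ then !x i else x i

/-- `adjFlip_fst` (planner qa-qnc0-p1 g36, exp36/PairSlice36.lean). -/
theorem adjFlip_fst (j : Fin N) (hj : j.val + 1 < N) (x : Fin N → Bool) : adjFlip j hj x j = !x j := by
  simp [adjFlip]

/-- `adjFlip_snd` (planner qa-qnc0-p1 g36, exp36/PairSlice36.lean). -/
theorem adjFlip_snd (j : Fin N) (hj : j.val + 1 < N) (x : Fin N → Bool) :
    adjFlip j hj x ⟨j.val + 1, hj⟩ = !x ⟨j.val + 1, hj⟩ := by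
  simp [adjFlip]

/-- `adjFlip_of_ne` (planner qa-qnc0-p1 g36, exp36/PairSlice36.lean). -/
theorem adjFlip_of_ne (j : Fin N) (hj : j.val + 1 < N) (x : Fin N → Bool) {i : Fin N} (h1 : i ≠ j)
    (h2 : i ≠ ⟨j.val + 1, hj⟩) : adjFlip j hj x i = x i := by
  simp [adjFlip, h1, h2]

/-- the pair `(j, j+1)` of `x` is BLIND for `γ`: tied with `γ_j + γ_{j+1} = 0`, or anti-tied with `γ_j = γ_{j+1}`. -/
def Blind (γ : Fin N → ZMod 3) (x : Fin N → Bool) (j : Fin N) (hj : j.val + 1 < N) : Prop :=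
  (x j = x ⟨j.val + 1, hj⟩ ∧ γ j + γ ⟨j.val + 1, hj⟩ = 0) ∨ (x j ≠ x ⟨j.val + 1, hj⟩ ∧ γ j = γ ⟨j.val + 1, hj⟩)

/-- for `γ_j, γ_{j+1} ≠ 0` exactly one of tied / anti-tied is blind: blindness is the bit `[x_j = x_{j+1}] = [γ_j ≠ γ_{j+1}]`. -/
theorem blind_iff (γ : Fin N → ZMod 3) (x : Fin N → Bool) (j : Fin N) (hj : j.val + 1 < N) (h0 : γ j ≠ 0)
    (h1 : γ ⟨j.val + 1, hj⟩ ≠ 0) : Blind γ x j hj ↔ (x j = x ⟨j.val + 1, hj⟩ ↔ γ j ≠ γ ⟨j.val + 1, hj⟩) := by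
  unfold Blind
  have key : γ j + γ ⟨j.val + 1, hj⟩ = 0 ↔ γ j ≠ γ ⟨j.val + 1, hj⟩ := by
    revert h0 h1; generalize γ j = a; generalize γ ⟨j.val + 1, hj⟩ = b; revert a b; decide
  rw [key]
  by_cases hx : x j = x ⟨j.val + 1, hj⟩
  · simp only [hx, true_and, ne_eq, not_true_eq_false, false_and, or_false, true_iff]
  · simp only [hx, false_and, ne_eq, not_false_eq_true, true_and, false_or, false_iff, not_not]

/-- **BLIND PAIRS ARE INVISIBLE TO ALIGNED FORMS.**  If `b`'s coefficients on the pair are `l·(γ_j, γ_{j+1})` and the pair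
is blind for `γ`, the form `b` does not see the flip. -/
theorem linForm_adjFlip_of_aligned (b γ : Fin N → ZMod 3) (j : Fin N) (hj : j.val + 1 < N) (x : Fin N → Bool)
    (hbl : Blind γ x j hj) (l : ZMod 3) (hb1 : b j = l * γ j) (hb2 : b ⟨j.val + 1, hj⟩ = l * γ ⟨j.val + 1, hj⟩) :
    linForm b (adjFlip j hj x) = linForm b x := by
  have hne : j ≠ ⟨j.val + 1, hj⟩ := by
    intro h; have := congrArg Fin.val h; simp at this
  unfold linForm
  rw [← sub_eq_zero, ← sum_sub_distrib]
  rw [sum_eq_add_of_mem j ⟨j.val + 1, hj⟩ (mem_univ _) (mem_univ _) hne]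
  · rw [adjFlip_fst, adjFlip_snd, hb1, hb2]
    rcases hbl with ⟨hx, hγ⟩ | ⟨hx, hγ⟩
    · have hγ' : γ ⟨j.val + 1, hj⟩ = -γ j := (neg_eq_of_add_eq_zero_right hγ).symm
      rw [← hx, hγ']
      cases x j <;> simp
    · have hx' : x ⟨j.val + 1, hj⟩ = !x j := by
        cases h : x j <;> cases h' : x ⟨j.val + 1, hj⟩ <;> simp_all
      rw [hx', ← hγ]
      cases x j <;> simp
  · intro i _ hi
    rw [adjFlip_of_ne j hj x hi.1 hi.2, sub_self]

/-! ### Pairings, alignment, the two boxes -/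

/-- an ADJACENT PAIRING: pair-first positions `j` (pairs `(j, j+1)`, kept away from the last coordinate), non-overlapping. -/
def IsPairing (P : Finset (Fin N)) : Prop :=
  ∀ j ∈ P, j.val + 2 < N ∧ ∀ j' ∈ P, j'.val ≠ j.val + 1

/-- row `k` of `β` is ALIGNED with `γ` at the pair `(j, j+1)`: its two coefficients there are a common multiple of `γ`'s
(`l = 0`: the row does not read the pair). -/
def RowAligned (β : Fin N → Fin N → ZMod 3) (γ : Fin N → ZMod 3) (k j : Fin N) : Prop :=
  ∀ hj : j.val + 1 < N, ∃ l : ZMod 3, β k j = l * γ j ∧ β k ⟨j.val + 1, hj⟩ = l * γ ⟨j.val + 1, hj⟩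

/-- the pairs of `P` at which row `k` is NOT aligned (these are the row's junta reads after slicing). -/
def misaligned (β : Fin N → Fin N → ZMod 3) (γ : Fin N → ZMod 3) (P : Finset (Fin N)) (k : Fin N) : Finset (Fin N) :=
  P.filter fun j => ¬ RowAligned β γ k j

/-- **ANALYTIC BOX, ALIGNMENT FORM — `PairAlignedHard`** (claimed provable from `AffBells22.walkHardAllSubcube` by PAIR
SLICING, see the module docstring; prover target).  One `θ < 1`: for every `C, c₀` and `N ≥ n₀(C, c₀)`, an affine MOD₃
bell strategy whose every row is aligned with a common `γ` (non-zero on the pairs) at all but `(log₂ N)^C` pairs of an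
adjacent pairing of size `≥ N/c₀` wins at most `θ·2^{N−1}` odd inputs (`θ = θ(c₀)`: the free fraction of the slices is
`≈ 1/(4c₀)`, and `WalkHardAllSubcube δ₀` hides its `θ`'s uniformity in `δ₀`).  Coefficients off the pairs are arbitrary. -/
def PairAlignedHard : Prop :=
  ∀ c₀ : ℕ, ∃ θ : ℝ, θ < 1 ∧ ∀ C : ℕ, ∃ n₀ : ℕ, ∀ N ≥ n₀,
    ∀ (β : Fin N → Fin N → ZMod 3) (c : Fin N → ZMod 3) (γ : Fin N → ZMod 3) (P : Finset (Fin N)),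
      IsPairing P → N ≤ c₀ * P.card → (∀ j ∈ P, γ j ≠ 0) → (∀ j ∈ P, ∀ hj : j.val + 1 < N, γ ⟨j.val + 1, hj⟩ ≠ 0) →
      (∀ k, (misaligned β γ P k).card ≤ (Nat.log 2 N) ^ C) →
        (affWinCard β c : ℝ) ≤ θ * (2 : ℝ) ^ (N - 1)

/-- **STRUCTURAL BOX, ALIGNMENT FORM — `NearPerfectAligned`** (OPEN; the last box re-typed).  Every near-perfect affine
strategy is aligned: some `γ` and an adjacent pairing of linear size align every row at all but polylog many pairs. -/
def NearPerfectAligned : Prop :=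
  ∃ e C c₀ n₀ : ℕ, ∀ N ≥ n₀, ∀ (β : Fin N → Fin N → ZMod 3) (c : Fin N → ZMod 3),
    (1 - 1 / (N : ℝ) ^ e) * (2 : ℝ) ^ (N - 1) < (affWinCard β c : ℝ) →
      ∃ (γ : Fin N → ZMod 3) (P : Finset (Fin N)), IsPairing P ∧ N ≤ c₀ * P.card ∧ (∀ j ∈ P, γ j ≠ 0) ∧
        (∀ j ∈ P, ∀ hj : j.val + 1 < N, γ ⟨j.val + 1, hj⟩ ≠ 0) ∧ ∀ k, (misaligned β γ P k).card ≤ (Nat.log 2 N) ^ C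

/-- **`PairAlignedHard → NearPerfectAligned → (NP₁)`.** -/
theorem polyLoss_of_alignment (hH : PairAlignedHard) (hA : NearPerfectAligned) : AffBellsPolyLoss3 := by
  obtain ⟨e, C, c₀, n₀, hal⟩ := hA
  obtain ⟨θ, hθ, hhard⟩ := hH c₀
  obtain ⟨n₁, hn₁⟩ := hhard C
  obtain ⟨M, hM⟩ := exists_nat_gt (1 / (1 - θ))
  refine ⟨e + 1, max (max n₀ n₁) (max M 2), fun N hN β c => ?_⟩
  have hNn₀ : n₀ ≤ N := le_trans (le_trans (le_max_left _ _) (le_max_left _ _)) hN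
  have hNn₁ : n₁ ≤ N := le_trans (le_trans (le_max_right _ _) (le_max_left _ _)) hN
  have hNM : M ≤ N := le_trans (le_trans (le_max_left _ _) (le_max_right _ _)) hN
  have hN2 : 2 ≤ N := le_trans (le_trans (le_max_right _ _) (le_max_right _ _)) hN
  have h1θ : 0 < 1 - θ := by linarith
  have hMpos : (0 : ℝ) < M := lt_trans (by positivity) hM
  have hMR : (M : ℝ) ≤ N := by exact_mod_cast hNM
  have hNpos : (0 : ℝ) < N := lt_of_lt_of_le hMpos hMR
  have hN1 : (1 : ℝ) ≤ N := by exact_mod_cast (show 1 ≤ N by omega)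
  have h2pos : (0 : ℝ) < (2 : ℝ) ^ (N - 1) := pow_pos (by norm_num) _
  by_contra hW
  rw [not_le] at hW
  have hmono : (1 - 1 / (N : ℝ) ^ e) * (2 : ℝ) ^ (N - 1) ≤ (1 - 1 / (N : ℝ) ^ (e + 1)) * (2 : ℝ) ^ (N - 1) := by
    apply mul_le_mul_of_nonneg_right _ h2pos.le
    have : 1 / (N : ℝ) ^ (e + 1) ≤ 1 / (N : ℝ) ^ e :=
      div_le_div_of_nonneg_left zero_le_one (by positivity) (pow_le_pow_right₀ hN1 (Nat.le_succ e))
    linarith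
  obtain ⟨γ, P, hP, hPc, hγ0, hγ1, hmis⟩ := hal N hNn₀ β c (lt_of_le_of_lt hmono hW)
  have hbound := hn₁ N hNn₁ β c γ P hP hPc hγ0 hγ1 hmis
  -- `1/N^(e+1) ≤ 1/N ≤ 1/M < 1 - θ`
  have hsmall : 1 / (N : ℝ) ^ (e + 1) < 1 - θ := by
    have ha : 1 / (N : ℝ) ^ (e + 1) ≤ 1 / (N : ℝ) := by
      apply div_le_div_of_nonneg_left zero_le_one hNpos
      calc (N : ℝ) = (N : ℝ) ^ 1 := (pow_one _).symm
        _ ≤ (N : ℝ) ^ (e + 1) := pow_le_pow_right₀ hN1 (by omega)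
    have hb : 1 / (N : ℝ) < 1 - θ := by
      calc 1 / (N : ℝ) ≤ 1 / (M : ℝ) := div_le_div_of_nonneg_left zero_le_one hMpos hMR
        _ < 1 - θ := by
            rw [div_lt_iff₀ hMpos]
            have := (div_lt_iff₀ h1θ).1 hM
            linarith
    linarith
  have key : (1 - 1 / (N : ℝ) ^ (e + 1)) * (2 : ℝ) ^ (N - 1) < θ * (2 : ℝ) ^ (N - 1) := lt_of_lt_of_le hW hbound
  have hcoef : 1 - 1 / (N : ℝ) ^ (e + 1) < θ := lt_of_mul_lt_mul_right key h2pos.le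
  linarith

end Summit.QuantumAdvantage.AdviceFreeQNC0.AffBells36
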